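import Literature.NumberTheory.GelbartRogawski1991.DoubledKroneckerConjugation
import Literature.NumberTheory.GelbartRogawski1991.DoubledWeilRepresentationDeltaFixingTransport
import HarnessLib

/-!
# The rational see-saw matrix of the doubled Kronecker conjugation and the `δ`-evaluation scalars of its Weil lift

[GelbartRogawski1991, §3.1 Prop. 3.1.1 p. 455 L1–2, p. 454]; [Kudla1984, §1]; [Kudla1994, §2, Thm. 3.1]; [Weil1964, Chap. III
n° 37 p. 188, n° 41 Thm 6 p. 193].  For the doubled Kronecker conjugation datum of `DoubledKroneckerConjugation(Theta)` — a rational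
isometry `a = a₀ ⊗ 1 : (V ⊗ 𝔸, diag dV′) ≅ (V ⊗ 𝔸, diag dV)`, a rational relabelling `C = C₀ ⊗ 1`, the doubled see-saw element
`seesawD = Res(kronAD e a) ∘ Λ_{relabCD e C}⁻¹ ∈ Sp(𝕎^𝔻)(𝔸)` and its Weil lift `rD = r_F(seesawD)`:
* §1 inverses of `kronAD`, `relabCD` (block-diagonal-equal);
* §2 the RATIONAL see-saw matrix `seesawDRat := untransportSp T^𝔻 (Λ_{C₀^𝔻}⁻¹ ∘ Res_{L/L⁺}(kronAD e a₀)) ∈ Sp_{2(n+n)}(L⁺)`,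
  `seesawD = ratSp seesawDRat` (`seesawConj_adele_eq_transportSp`) and **`rD = r_F^𝔻(seesawDRat)`** (`rD_eq_rFD`);
* §3 `seesawDRat^{±1}` preserve the Darboux-diagonal vectors `P(a,a;z,z)`;
* §4 hence `u := r_Δ rD⁻¹ r_Δ⁻¹` and `u⁻¹` fix the value at the origin (`DoubledWeilRepresentationDeltaFixingTransport` §4) and
  **`hpar_rD`**: `conjRelabel rD (relabCD e C) _` transports the `δ`-evaluation scalars of [GelbartRogawski1991, Prop. 3.1.1]
  (the `hpar` input of the doubled-isometry transport of `ω^𝔻_χ`).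
-/

set_option autoImplicit false

noncomputable section

namespace Literature.NumberTheory.GelbartRogawski1991.GRConstruction

open Matrix NumberField IsDedekindDomain
open scoped Kronecker
open Literature.RepresentationTheory.HeisenbergGroup Literature.RepresentationTheory.HeisenbergGroup.SymplecticMatrix
  Literature.NumberTheory.Weil1964
open Literature.NumberTheory.Automorphic
open UnitaryDualPair Literature.NumberTheory.Automorphic.UnitaryGroup

section SeesawRational

variable (L : Type) [Field L] [NumberField L] [IsCMField L]
  {N M n : ℕ} (e : Fin N × Fin M ≃ Fin n)
  (dV : Fin N → L) (hdV : ∀ i, IsCMField.complexConj L (dV i) = dV i) (hdV0 : ∀ i, dV i ≠ 0)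
  (dV' : Fin N → L) (hdV' : ∀ i, IsCMField.complexConj L (dV' i) = dV' i) (hdV'0 : ∀ i, dV' i ≠ 0)
  (dW : Fin M → L) (hdW : ∀ i, IsCMField.complexConj L (dW i) = dW i) (hdW0 : ∀ i, dW i ≠ 0)

/-! ## §1 Inverses of `kronAD`, `relabCD` -/

/-- `(kronAD e a)⁻¹ = reindex_{e₂}((kronA e a)⁻¹ ⊕ (kronA e a)⁻¹)`. [cite: Kudla1994, §2 (doubled space, Siegel parabolic), Thm. 3.1] -/
theorem kronAD_inv {S : Type*} [CommRing S] (a : GL (Fin N) S) :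
    (kronAD e a)⁻¹ = reindexGL (e₂ (n := n)) (blockDiagGL ((kronA e a)⁻¹, (kronA e a)⁻¹)) := by
  rw [kronAD_def, ← Prod.inv_mk, map_inv, map_inv]

/-- `(relabCD e C)⁻¹ = reindex_{e₂}((relabC e C)⁻¹ ⊕ (relabC e C)⁻¹)`. [cite: Kudla1994, §2 (doubled space, Siegel parabolic), Thm. 3.1] -/
theorem relabCD_inv {S : Type*} [CommRing S] (C : GL (Fin N × Fin M) S) :
    (relabCD e C)⁻¹ = reindexGL (e₂ (n := n)) (blockDiagGL ((relabC e C)⁻¹, (relabC e C)⁻¹)) := by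
  rw [relabCD_def, ← Prod.inv_mk, map_inv, map_inv]

/-! ## §2 The rational see-saw matrix `seesawDRat` and `rD = r_F^𝔻(seesawDRat)` -/

/-- the rational quadratic coordinates `L = L⁺ ⊕ L⁺·δ_L` of record (`isQuadraticCoordinates_rat`; cf. the adelic `qc`). [folklore] -/
private abbrev qcr := UnitaryGroup.isQuadraticCoordinates_rat L (IsCMField.complexConj L) (complexConj_imagUnit L)
  (imagUnit_ne_zero L) (imagUnit_mul_self L)

-- (no local notation inside `variable` binders: a notation capturing the section variable `L` elaborates to `sorry` there)
variable {a : GL (Fin N) (AdeleRing (𝓞 L) L)} {a₀ : GL (Fin N) L}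
  (haa₀ : (a : Matrix (Fin N) (Fin N) (AdeleRing (𝓞 L) L)) =
    ((a₀ : GL (Fin N) L) : Matrix (Fin N) (Fin N) L).map (algebraMap L (AdeleRing (𝓞 L) L)))
  (ha : ((a : Matrix (Fin N) (Fin N) (AdeleRing (𝓞 L) L)).map (conjAdele (Fp L) L (IsCMField.complexConj L)))ᵀ *
      adelicForm L N (Matrix.diagonal dV) * a = adelicForm L N (Matrix.diagonal dV'))
  {C : GL (Fin N × Fin M) (AdeleRing (𝓞 (Fp L)) (Fp L))} {C₀ : GL (Fin N × Fin M) (Fp L)}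
  (hCC₀ : (C : Matrix (Fin N × Fin M) (Fin N × Fin M) (AdeleRing (𝓞 (Fp L)) (Fp L))) =
    ((C₀ : GL (Fin N × Fin M) (Fp L)) : Matrix (Fin N × Fin M) (Fin N × Fin M) (Fp L)).map
      (algebraMap (Fp L) (AdeleRing (𝓞 (Fp L)) (Fp L))))
  (hC : (realDiagonal L dV hdV).map (algebraMap (Fp L) (AdeleRing (𝓞 (Fp L)) (Fp L))) ⊗ₖ
        (realDiagonal L dW hdW).map (algebraMap (Fp L) (AdeleRing (𝓞 (Fp L)) (Fp L))) *
      (C : Matrix (Fin N × Fin M) (Fin N × Fin M) (AdeleRing (𝓞 (Fp L)) (Fp L))) =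
    (realDiagonal L dV' hdV').map (algebraMap (Fp L) (AdeleRing (𝓞 (Fp L)) (Fp L))) ⊗ₖ
      (realDiagonal L dW hdW).map (algebraMap (Fp L) (AdeleRing (𝓞 (Fp L)) (Fp L))))

include haa₀ ha in
/-- **the rational Kronecker matrix is a rational isometry** `(kronAD e a₀ : (L^{n+n}, T^𝔻[dV′] ⊗ 1) ≅ (L^{n+n}, T^𝔻[dV] ⊗ 1)`
(★ `isometry_of_map_adele` applied to `kronAD_isometry`, `kronAD e a = (kronAD e a₀) ⊗ 1`). [cite: Kudla1984, §1] -/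
theorem kronAD_isometry_gramD_rat :
    (((kronAD e a₀ : GL (Fin (n + n)) L) : Matrix (Fin (n + n)) (Fin (n + n)) L).map
          ((IsCMField.complexConj L : L ≃ₐ[Fp L] L) : L →+* L))ᵀ *
        (gramD L e dV hdV dW hdW).map (algebraMap (Fp L) L) * ((kronAD e a₀ : GL (Fin (n + n)) L) : Matrix (Fin (n + n)) (Fin (n + n)) L) =
      (gramD L e dV' hdV' dW hdW).map (algebraMap (Fp L) L) :=
  isometry_of_map_adele (Fp L) L (IsCMField.complexConj L) (by
    rw [← coe_kronAD_map e (algebraMap L (AdeleRing (𝓞 L) L)) a₀ haa₀,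
      ← adelicForm_eq_map_map L (n + n) (gramD L e dV hdV dW hdW) (J := hermD L e dV hdV dW hdW) rfl,
      ← adelicForm_eq_map_map L (n + n) (gramD L e dV' hdV' dW hdW) (J := hermD L e dV' hdV' dW hdW) rfl]
    exact kronAD_isometry L e dV hdV dV' hdV' dW hdW a ha)

include hCC₀ hC in
/-- **the rational relabelling identity** `T^𝔻[dV] · relabCD e C₀ = T^𝔻[dV′]` (★ `mul_eq_of_map_adele` applied to `gramDA_mul_relabCD`).
[cite: Kudla1994, §2 (doubled space, Siegel parabolic), Thm. 3.1] -/
theorem gramD_mul_relabCD_rat :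
    gramD L e dV hdV dW hdW * ((relabCD e C₀ : GL (Fin (n + n)) (Fp L)) : Matrix (Fin (n + n)) (Fin (n + n)) (Fp L)) =
      gramD L e dV' hdV' dW hdW :=
  mul_eq_of_map_adele (Fp L) (by
    rw [← coe_relabCD_map e (algebraMap (Fp L) (AdeleRing (𝓞 (Fp L)) (Fp L))) C₀ hCC₀]
    exact gramDA_mul_relabCD L e dV hdV dV' hdV' dW hdW C hC)

/-- **the RATIONAL see-saw matrix `B₀ := untransportSp T^𝔻 (Λ_{C₀^𝔻}⁻¹ ∘ Res_{L/L⁺}(kronAD e a₀)) ∈ Sp_{2(n+n)}(L⁺)`** — Mathlib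
coordinates of the see-saw conjugation element of the RATIONAL data `(a₀, C₀)` (★ `IsQuadraticCoordinates.seesawConj` over `L/L⁺`,
★ `SpTransport.untransportSp`). [cite: Kudla1984, §1] [cite: Weil1964, Chap. III n° 37 p. 188] -/
def seesawDRat : Matrix.symplecticGroup (Fin (n + n)) (Fp L) :=
  SpTransport.untransportSp (gramD L e dV hdV dW hdW) (isUnit_det_gramD L e dV hdV hdV0 dW hdW hdW0)
    ((qcr L).seesawConj (Fin (n + n)) (gramD_isSymm L e dV hdV dW hdW) (gramD_isSymm L e dV' hdV' dW hdW)
      (σ := ((IsCMField.complexConj L : L ≃ₐ[Fp L] L) : L →+* L)) (fun x => (IsCMField.complexConj L).commutes x)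
      (complexConj_imagUnit L) rfl rfl (kronAD e a₀) (kronAD_isometry_gramD_rat L e dV hdV dV' hdV' dW hdW haa₀ ha) (relabCD e C₀)
      (gramD_mul_relabCD_rat L e dV hdV dV' hdV' dW hdW hCC₀ hC))

include hdV0 hdW0 haa₀ hCC₀ in
/-- **`h₀^𝔻 = ratSp B₀`**: the adelic see-saw element is the rational point `B₀ ⊗ 1` (★ `seesawConj_adele_eq_transportSp`).
[cite: Weil1964, Chap. III n° 37 p. 188] [cite: GelbartRogawski1991, §3.1 p. 454] -/
theorem seesawD_eq_ratSp :
    seesawD L e dV hdV dV' hdV' dW hdW a ha C hC =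
      ratSp (Fp L) (gramDA L e dV hdV dW hdW) (isUnit_det_gramDA L e dV hdV hdV0 dW hdW hdW0)
        (seesawDRat L e dV hdV hdV0 dV' hdV' dW hdW hdW0 haa₀ ha hCC₀ hC) :=
  seesawConj_adele_eq_transportSp (Fp L) L (IsCMField.complexConj L) (complexConj_imagUnit L) (imagUnit_ne_zero L)
    (imagUnit_mul_self L) (gramD_isSymm L e dV hdV dW hdW) (gramD_isSymm L e dV' hdV' dW hdW)
    (isUnit_det_gramD L e dV hdV hdV0 dW hdW hdW0) rfl rfl ((gramD_isSymm L e dV hdV dW hdW).map _)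
    ((gramD_isSymm L e dV' hdV' dW hdW).map _) (isUnit_det_gramDA L e dV hdV hdV0 dW hdW hdW0)
    (adelicForm_eq_map_map L (n + n) (gramD L e dV hdV dW hdW) (J := hermD L e dV hdV dW hdW) rfl)
    (adelicForm_eq_map_map L (n + n) (gramD L e dV' hdV' dW hdW) (J := hermD L e dV' hdV' dW hdW) rfl)
    (g₀ := kronAD e a₀) (coe_kronAD_map e (algebraMap L (AdeleRing (𝓞 L) L)) a₀ haa₀) (kronAD_isometry L e dV hdV dV' hdV' dW hdW a ha)
    (C₀ := relabCD e C₀) (coe_relabCD_map e (algebraMap (Fp L) (AdeleRing (𝓞 (Fp L)) (Fp L))) C₀ hCC₀) (gramDA_mul_relabCD L e dV hdV dV' hdV' dW hdW C hC)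

include hdV0 hdW0 haa₀ hCC₀ in
/-- **`r^𝔻 = r_F^𝔻(B₀)`**: Weil's lift of the rational point `h₀^𝔻` is `rFD` of the rational see-saw matrix
(`ratPointsThetaLiftCont = r_F ∘ (ratSpιRangeEquiv)⁻¹`, ★ `ratPointsThetaLiftCont_ratSpιRangeEquiv`, ★ `ratThetaLiftContι_fin`).
[cite: Weil1964, Chap. III n° 41 Thm 6 p. 193] [cite: GelbartRogawski1991, §3.1 p. 454] -/
theorem rD_eq_rFD :
    rD L e dV hdV hdV0 dV' hdV' dW hdW hdW0 haa₀ ha hCC₀ hC =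
      rFD L e dV hdV hdV0 dW hdW hdW0 (seesawDRat L e dV hdV hdV0 dV' hdV' dW hdW hdW0 haa₀ ha hCC₀ hC) := by
  have hx : (⟨seesawD L e dV hdV dV' hdV' dW hdW a ha C hC,
      seesawD_mem_range L e dV hdV hdV0 dV' hdV' dW hdW hdW0 haa₀ ha hCC₀ hC⟩ :
        ((transportSp (gramDA L e dV hdV dW hdW) (isUnit_det_gramDA L e dV hdV hdV0 dW hdW hdW0)).comp
          (mapHom (algebraMap (Fp L) (AdeleRing (𝓞 (Fp L)) (Fp L))))).range) =
      ratSpιRangeEquiv (Fp L) (Fin (n + n)) (gramDA L e dV hdV dW hdW) (isUnit_det_gramDA L e dV hdV hdV0 dW hdW hdW0)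
        (seesawDRat L e dV hdV hdV0 dV' hdV' dW hdW hdW0 haa₀ ha hCC₀ hC) :=
    Subtype.ext ((seesawD_eq_ratSp L e dV hdV hdV0 dV' hdV' dW hdW hdW0 haa₀ ha hCC₀ hC).trans
      (coe_ratSpιRangeEquiv (Fp L) (Fin (n + n)) (gramDA L e dV hdV dW hdW) (isUnit_det_gramDA L e dV hdV hdV0 dW hdW hdW0)
        (seesawDRat L e dV hdV hdV0 dV' hdV' dW hdW hdW0 haa₀ ha hCC₀ hC)).symm)
  exact (congrArg (ratPointsThetaLiftCont (Fp L) (Fin (n + n)) (gramDA L e dV hdV dW hdW)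
      (isUnit_det_gramDA L e dV hdV hdV0 dW hdW hdW0)) hx).trans
    ((ratPointsThetaLiftCont_ratSpιRangeEquiv (Fp L) (Fin (n + n)) (gramDA L e dV hdV dW hdW)
        (isUnit_det_gramDA L e dV hdV hdV0 dW hdW hdW0) _).trans
      (ratThetaLiftContι_fin (Fp L) (gramDA L e dV hdV dW hdW) (isUnit_det_gramDA L e dV hdV hdV0 dW hdW hdW0) _))

/-! ## §3 `B₀^{±1}` preserve the Darboux-diagonal vectors `P(a,a;z,z) = ((a,a); T^𝔻(z,z))` -/

/-- `P(a,a;z,z)` is `darboux T^𝔻` of the pair of diagonal vectors `((a,a), (z,z))`. [folklore] -/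
private theorem sumElim_diag_eq_darboux (hT : IsUnit (gramD L e dV hdV dW hdW).det) (a z : Fin n → Fp L) :
    Sum.elim (Sum.elim a a ∘ ⇑(e₂ (n := n)).symm) (gramD L e dV hdV dW hdW *ᵥ (Sum.elim z z ∘ ⇑(e₂ (n := n)).symm)) =
      SymplecticMatrix.darboux (gramD L e dV hdV dW hdW) hT (Sum.elim a a ∘ ⇑(e₂ (n := n)).symm, Sum.elim z z ∘ ⇑(e₂ (n := n)).symm) :=
  rfl

include hdV0 hdW0 haa₀ ha hCC₀ hC in
/-- **`B₀` maps Darboux-diagonal vectors to Darboux-diagonal vectors**: `Λ_{C₀^𝔻}⁻¹` keeps `(z,z)` diagonal (`relabCD = reindex_{e₂}(C̃ ⊕ C̃)`),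
`Res(kronAD e a₀)` maps `reIm⁻¹((a,a),(z₁,z₁)) = (W,W)` to `(kW, kW)`, whose `reIm` is again a pair of diagonal vectors.
[cite: Kudla1984, §1] [cite: GelbartRogawski1991, §3.1 Prop. 3.1.1 p. 455 L1–2] -/
theorem seesawDRat_mulVec_diag (a' z : Fin n → Fp L) : ∃ a'' z'' : Fin n → Fp L,
    ((seesawDRat L e dV hdV hdV0 dV' hdV' dW hdW hdW0 haa₀ ha hCC₀ hC : Matrix.symplecticGroup (Fin (n + n)) (Fp L)) :
        Matrix (Fin (n + n) ⊕ Fin (n + n)) (Fin (n + n) ⊕ Fin (n + n)) (Fp L)) *ᵥ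
        Sum.elim (Sum.elim a' a' ∘ ⇑(e₂ (n := n)).symm) (gramD L e dV hdV dW hdW *ᵥ (Sum.elim z z ∘ ⇑(e₂ (n := n)).symm)) =
      Sum.elim (Sum.elim a'' a'' ∘ ⇑(e₂ (n := n)).symm) (gramD L e dV hdV dW hdW *ᵥ (Sum.elim z'' z'' ∘ ⇑(e₂ (n := n)).symm)) := by
  obtain ⟨Ψ, hΨ⟩ : ∃ Ψ : (Fp L × Fp L) ≃+ L, ∀ (g : GL (Fin (n + n)) L) (x : Fin (n + n) → L),
      (qcr L).resAut (Fin (n + n)) g (UnitaryGroup.QuadraticCoordinates.reIm Ψ (Fin (n + n)) x) =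
        UnitaryGroup.QuadraticCoordinates.reIm Ψ (Fin (n + n)) ((g : Matrix (Fin (n + n)) (Fin (n + n)) L) *ᵥ x) :=
    ⟨_, (qcr L).resAut_reIm (Fin (n + n))⟩
  -- the intermediate vectors
  let z₁ : Fin n → Fp L := (((relabC e C₀)⁻¹ : GL (Fin n) (Fp L)) : Matrix (Fin n) (Fin n) (Fp L)) *ᵥ z
  let W : Fin n → L := fun i => Ψ (a' i, z₁ i)
  let W' : Fin n → L := ((kronA e a₀ : GL (Fin n) L) : Matrix (Fin n) (Fin n) L) *ᵥ W
  refine ⟨fun i => UnitaryGroup.QuadraticCoordinates.re Ψ (W' i), fun i => UnitaryGroup.QuadraticCoordinates.im Ψ (W' i), ?_⟩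
  rw [seesawDRat, SpTransport.coe_untransportSp, sumElim_diag_eq_darboux L e dV hdV dW hdW (isUnit_det_gramD L e dV hdV hdV0 dW hdW hdW0),
    sumElim_diag_eq_darboux L e dV hdV dW hdW (isUnit_det_gramD L e dV hdV hdV0 dW hdW hdW0), SpTransport.untransportMatrix_mulVec,
    LinearEquiv.symm_apply_apply]
  refine congrArg (SymplecticMatrix.darboux (gramD L e dV hdV dW hdW) (isUnit_det_gramD L e dV hdV hdV0 dW hdW hdW0)) ?_
  change (qcr L).resAut (Fin (n + n)) (kronAD e a₀) (Sum.elim a' a' ∘ ⇑(e₂ (n := n)).symm,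
      (((relabCD e C₀)⁻¹ : GL (Fin (n + n)) (Fp L)) : Matrix (Fin (n + n)) (Fin (n + n)) (Fp L)) *ᵥ
        (Sum.elim z z ∘ ⇑(e₂ (n := n)).symm)) = _
  rw [relabCD_inv, reindexGL_blockDiagGL_mulVec_diag,
    ← (UnitaryGroup.QuadraticCoordinates.reIm Ψ (Fin (n + n))).apply_symm_apply
      (Sum.elim a' a' ∘ ⇑(e₂ (n := n)).symm, Sum.elim z₁ z₁ ∘ ⇑(e₂ (n := n)).symm),
    reIm_symm_diag L Ψ a' z₁, hΨ, kronAD_def, reindexGL_blockDiagGL_mulVec_diag, reIm_diag]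

include hdV0 hdW0 haa₀ ha hCC₀ hC in
/-- **`B₀⁻¹` maps Darboux-diagonal vectors to Darboux-diagonal vectors** (`B₀⁻¹ = untransportSp (Res(kronAD e a₀)⁻¹ ≫ Λ_{C₀^𝔻})`,
`Res(g)⁻¹ = Res(g⁻¹)`, `(kronAD e a₀)⁻¹ = reindex_{e₂}(k⁻¹ ⊕ k⁻¹)`). [cite: Kudla1984, §1] [cite: GelbartRogawski1991, §3.1 Prop. 3.1.1 p. 455 L1–2] -/
theorem seesawDRat_inv_mulVec_diag (a' z : Fin n → Fp L) : ∃ a'' z'' : Fin n → Fp L,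
    (((seesawDRat L e dV hdV hdV0 dV' hdV' dW hdW hdW0 haa₀ ha hCC₀ hC)⁻¹ : Matrix.symplecticGroup (Fin (n + n)) (Fp L)) :
        Matrix (Fin (n + n) ⊕ Fin (n + n)) (Fin (n + n) ⊕ Fin (n + n)) (Fp L)) *ᵥ
        Sum.elim (Sum.elim a' a' ∘ ⇑(e₂ (n := n)).symm) (gramD L e dV hdV dW hdW *ᵥ (Sum.elim z z ∘ ⇑(e₂ (n := n)).symm)) =
      Sum.elim (Sum.elim a'' a'' ∘ ⇑(e₂ (n := n)).symm) (gramD L e dV hdV dW hdW *ᵥ (Sum.elim z'' z'' ∘ ⇑(e₂ (n := n)).symm)) := by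
  obtain ⟨Ψ, hΨ⟩ : ∃ Ψ : (Fp L × Fp L) ≃+ L, ∀ (g : GL (Fin (n + n)) L) (x : Fin (n + n) → L),
      (qcr L).resAut (Fin (n + n)) g (UnitaryGroup.QuadraticCoordinates.reIm Ψ (Fin (n + n)) x) =
        UnitaryGroup.QuadraticCoordinates.reIm Ψ (Fin (n + n)) ((g : Matrix (Fin (n + n)) (Fin (n + n)) L) *ᵥ x) :=
    ⟨_, (qcr L).resAut_reIm (Fin (n + n))⟩
  let W : Fin n → L := fun i => Ψ (a' i, z i)
  let W' : Fin n → L := (((kronA e a₀)⁻¹ : GL (Fin n) L) : Matrix (Fin n) (Fin n) L) *ᵥ W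
  refine ⟨fun i => UnitaryGroup.QuadraticCoordinates.re Ψ (W' i),
    ((relabC e C₀ : GL (Fin n) (Fp L)) : Matrix (Fin n) (Fin n) (Fp L)) *ᵥ fun i => UnitaryGroup.QuadraticCoordinates.im Ψ (W' i), ?_⟩
  rw [seesawDRat, ← map_inv (SpTransport.untransportSp (gramD L e dV hdV dW hdW) (isUnit_det_gramD L e dV hdV hdV0 dW hdW hdW0)),
    SpTransport.coe_untransportSp, sumElim_diag_eq_darboux L e dV hdV dW hdW (isUnit_det_gramD L e dV hdV hdV0 dW hdW hdW0),
    sumElim_diag_eq_darboux L e dV hdV dW hdW (isUnit_det_gramD L e dV hdV hdV0 dW hdW hdW0), SpTransport.untransportMatrix_mulVec,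
    LinearEquiv.symm_apply_apply, Subgroup.coe_inv, LinearEquiv.coe_inv]
  refine congrArg (SymplecticMatrix.darboux (gramD L e dV hdV dW hdW) (isUnit_det_gramD L e dV hdV hdV0 dW hdW hdW0)) ?_
  have hsy : ∀ v, ((qcr L).resAut (Fin (n + n)) (kronAD e a₀)).symm v = (qcr L).resAut (Fin (n + n)) (kronAD e a₀)⁻¹ v := fun v => by
    rw [map_inv, LinearEquiv.coe_inv]
  rw [IsQuadraticCoordinates.coe_seesawConj, LinearEquiv.symm_trans_apply, LinearEquiv.symm_symm, relabelEquiv_apply, hsy,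
    ← (UnitaryGroup.QuadraticCoordinates.reIm Ψ (Fin (n + n))).apply_symm_apply
      (Sum.elim a' a' ∘ ⇑(e₂ (n := n)).symm, Sum.elim z z ∘ ⇑(e₂ (n := n)).symm),
    reIm_symm_diag L Ψ a' z, hΨ, kronAD_inv, reindexGL_blockDiagGL_mulVec_diag, reIm_diag]
  dsimp only
  rw [relabCD_def, reindexGL_blockDiagGL_mulVec_diag]

/-! ## §4 The transport of the `δ`-evaluation scalars for the model conjugator `rD` -/

include hdV0 hdW0 haa₀ hCC₀ in
set_option maxHeartbeats 1000000 in
-- (one `MpD` telescope)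
/-- `hu0` for `rD`: `ω(r_Δ · rD⁻¹ · r_Δ⁻¹) Ψ (0) = Ψ(0)`. [cite: GelbartRogawski1991, §3.1 Prop. 3.1.1 p. 455 L1–2] [cite: Weil1964, Chap. I n° 13 p. 160] -/
theorem opD_rDelta_conj_rD_inv_apply_zero (Ψ : piSchwartzBruhat (Fp L) (Fin (n + n))) :
    opD L e dV hdV dW hdW (rDelta L e dV hdV hdV0 dW hdW hdW0 * (rD L e dV hdV hdV0 dV' hdV' dW hdW hdW0 haa₀ ha hCC₀ hC)⁻¹ *
        (rDelta L e dV hdV hdV0 dW hdW hdW0)⁻¹) Ψ 0 = (Ψ : (Fin (n + n) → AdeleRing (𝓞 (Fp L)) (Fp L)) → ℂ) 0 :=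
  (congrArg (fun r : MpD L e dV hdV dW hdW => opD L e dV hdV dW hdW
      (rDelta L e dV hdV hdV0 dW hdW hdW0 * r⁻¹ * (rDelta L e dV hdV hdV0 dW hdW hdW0)⁻¹) Ψ 0)
    (rD_eq_rFD L e dV hdV hdV0 dV' hdV' dW hdW hdW0 haa₀ ha hCC₀ hC)).trans
    (opD_rDelta_conj_rFD_inv_apply_zero L e dV hdV hdV0 dW hdW hdW0 _
      (seesawDRat_inv_mulVec_diag L e dV hdV hdV0 dV' hdV' dW hdW hdW0 haa₀ ha hCC₀ hC) Ψ)

include hdV0 hdW0 haa₀ hCC₀ in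
set_option maxHeartbeats 1000000 in
-- (one `MpD` telescope)
/-- `hu0′` for `rD`: `ω((r_Δ · rD⁻¹ · r_Δ⁻¹)⁻¹) Ψ (0) = Ψ(0)`. [cite: GelbartRogawski1991, §3.1 Prop. 3.1.1 p. 455 L1–2] [cite: Weil1964, Chap. I n° 13 p. 160] -/
theorem opD_rDelta_conj_rD_inv_inv_apply_zero (Ψ : piSchwartzBruhat (Fp L) (Fin (n + n))) :
    opD L e dV hdV dW hdW (rDelta L e dV hdV hdV0 dW hdW hdW0 * (rD L e dV hdV hdV0 dV' hdV' dW hdW hdW0 haa₀ ha hCC₀ hC)⁻¹ *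
        (rDelta L e dV hdV hdV0 dW hdW hdW0)⁻¹)⁻¹ Ψ 0 = (Ψ : (Fin (n + n) → AdeleRing (𝓞 (Fp L)) (Fp L)) → ℂ) 0 :=
  (congrArg (fun r : MpD L e dV hdV dW hdW => opD L e dV hdV dW hdW
      (rDelta L e dV hdV hdV0 dW hdW hdW0 * r⁻¹ * (rDelta L e dV hdV hdV0 dW hdW hdW0)⁻¹)⁻¹ Ψ 0)
    (rD_eq_rFD L e dV hdV hdV0 dV' hdV' dW hdW hdW0 haa₀ ha hCC₀ hC)).trans
    (opD_rDelta_conj_rFD_inv_inv_apply_zero L e dV hdV hdV0 dW hdW hdW0 _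
      (seesawDRat_mulVec_diag L e dV hdV hdV0 dV' hdV' dW hdW hdW0 haa₀ ha hCC₀ hC) Ψ)

include hdV0 hdV'0 hdW0 haa₀ hCC₀ in
set_option maxHeartbeats 1000000 in
-- (two `MpD` telescopes)
/-- **the transport of the `δ`-evaluation scalars for the MODEL conjugator, NO HYPOTHESIS**: for `r := rD` (Weil's lift of the doubled see-saw element of the
rational data `(a₀ ⊗ 1, C₀ ⊗ 1)`) and the doubled relabelling `relabCD e C`, `conjRelabel r C hC` transports `δ`-evaluation scalars:
`(∀ Ψ, ω(r_Δ X r_Δ⁻¹) Ψ (0) = c·Ψ(0)) → ∀ Φ, ω(r′_Δ · conjRelabel r C hC X · r′_Δ⁻¹) Φ (0) = c·Φ(0)` — `hpar_of_delta_fixing` at the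
`δ₀`-fixing of `u^{±1}` (§3, `DoubledWeilRepresentationDeltaFixingTransport` §4). [cite: GelbartRogawski1991, §3.1 Prop. 3.1.1 p. 455 L1–2] [cite: Weil1964, Chap. I n° 13 p. 160; Chap. III n° 41 Thm 6 p. 193]
[cite: Kudla1994, §2 (doubled space, Siegel parabolic), Thm. 3.1] -/
theorem hpar_rD (X : MpD L e dV hdV dW hdW) (c : ℂ)
    (hX : ∀ Ψ : piSchwartzBruhat (Fp L) (Fin (n + n)),
      opD L e dV hdV dW hdW (rDelta L e dV hdV hdV0 dW hdW hdW0 * X * (rDelta L e dV hdV hdV0 dW hdW hdW0)⁻¹) Ψ 0 =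
        c * (Ψ : (Fin (n + n) → AdeleRing (𝓞 (Fp L)) (Fp L)) → ℂ) 0)
    (Φ : piSchwartzBruhat (Fp L) (Fin (n + n))) :
    opD L e dV' hdV' dW hdW (rDelta L e dV' hdV' hdV'0 dW hdW hdW0 *
        conjRelabel (Fp L) (Fin (n + n)) (rD L e dV hdV hdV0 dV' hdV' dW hdW hdW0 haa₀ ha hCC₀ hC) (relabCD e C)
          (gramDA_mul_relabCD L e dV hdV dV' hdV' dW hdW C hC) X *
      (rDelta L e dV' hdV' hdV'0 dW hdW hdW0)⁻¹) Φ 0 = c * (Φ : (Fin (n + n) → AdeleRing (𝓞 (Fp L)) (Fp L)) → ℂ) 0 :=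
  hpar_of_delta_fixing (hdV0 := hdV0) (hdV'0 := hdV'0) (hdW0 := hdW0) (relabCD e C)
    (gramDA_mul_relabCD L e dV hdV dV' hdV' dW hdW C hC) (rD L e dV hdV hdV0 dV' hdV' dW hdW hdW0 haa₀ ha hCC₀ hC)
    (opD_rDelta_conj_rD_inv_apply_zero L e dV hdV hdV0 dV' hdV' dW hdW hdW0 haa₀ ha hCC₀ hC)
    (opD_rDelta_conj_rD_inv_inv_apply_zero L e dV hdV hdV0 dV' hdV' dW hdW hdW0 haa₀ ha hCC₀ hC) X c hX Φ

end SeesawRational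

end Literature.NumberTheory.GelbartRogawski1991.GRConstruction

end
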